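import Mathlib
import HarnessLib
import Summits.ABC.ABC.Theses.CongruentialReceptacle
import Summits.ABC.ABC.Theorems.CongruentialReceptacleAssembly
import Summits.ABC.ABC.Theorems.CongruentialReceptacleTameLocalReceptacleGivesTarget
import Summits.ABC.ABC.Theorems.CongruentialReceptacleQuarterWindowGivesCrux
import Summits.ABC.ABC.Theorems.CongruentialReceptacleAbelianWeightsVanish
import Summits.ABC.ABC.Theorems.CongruentialReceptacleCongruenceToEquality
import Summits.ABC.ABC.Theorems.CongruentialReceptacleBalancedFreySzpiroPort
import Summits.ABC.ABC.Theorems.CompactBalanceTransfer.Negative.ResidualOfTarget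

/-!
# Suspect-equivalence probe for crux `CompactBalanceTransfer` (stmt-ABC-1725), seat q1 — MUST-PASS half

rc 0 expected. Records (kernel-checked):
* the five PROVED route items are theorems of the tree, with their axiom closures;
* `S → B` (the crux is a consequence of the summit) and the CONDITIONAL equivalences of the witness file;
* the exact residual shape `S ↔ Target ∧ B` and `¬B ↔ Target ∧ ¬S`;
* non-vacuity anchors: the compactly balanced cell is inhabited at every height (`(n, n+1, 2n+1)`), so the
  Target / `H` quantify over an infinite family; and `Assembly` minus either binder is an OPEN statement
  (see the must-fail half F1/F8), i.e. both binders are load-bearing.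
-/

open Summit.ABC.ABC.Theses.CongruentialReceptacle
open Literature.NumberTheory.DiophantineGeometry

-- proved siblings, by name
example : TameLocalReceptacleGivesTarget := Summit.ABC.ABC.Theorems.TameLocalReceptacleGivesTarget_proof
example : Assembly := Summit.ABC.ABC.Theorems.congruentialReceptacle_assembly_proof
example : QuarterWindowGivesCrux := Summit.ABC.ABC.Theorems.quarterWindowGivesCrux_proof
example : AbelianWeightsVanish := Summit.ABC.ABC.Theorems.abelianWeightsVanish_proof
example : CongruenceToEquality := Summit.ABC.ABC.Theorems.congruenceToEquality_proof

#print axioms Summit.ABC.ABC.Theorems.TameLocalReceptacleGivesTarget_proof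
#print axioms Summit.ABC.ABC.Theorems.congruentialReceptacle_assembly_proof
#print axioms Summit.ABC.ABC.Theorems.quarterWindowGivesCrux_proof
#print axioms Summit.ABC.ABC.Theorems.abelianWeightsVanish_proof
#print axioms Summit.ABC.ABC.Theorems.congruenceToEquality_proof
#print axioms Summit.ABC.ABC.Theorems.balancedFreySzpiro_of_abc
#print axioms Summit.ABC.ABC.Theorems.CompactBalanceTransfer.Negative.compactBalanceTransfer_iff_abc_of_target
#print axioms Summit.ABC.ABC.Theorems.CompactBalanceTransfer.Negative.abc_iff_target_and_compactBalanceTransfer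

-- S → B : the crux is a consequence of the summit (unconditional, one line)
example : _root_.ABC → CompactBalanceTransfer := fun h _ => h

-- the witness: B ↔ S GIVEN the open Target (conditional_on stmt-ABC-1723), resp. the open rank-2 crux (stmt-ABC-14354)
example (hX : BalancedFreySzpiro) : CompactBalanceTransfer ↔ _root_.ABC :=
  Summit.ABC.ABC.Theorems.CompactBalanceTransfer.Negative.compactBalanceTransfer_iff_abc_of_target hX
example (hR : TameLocalReceptacle) : CompactBalanceTransfer ↔ _root_.ABC :=
  Summit.ABC.ABC.Theorems.CompactBalanceTransfer.Negative.compactBalanceTransfer_iff_abc_of_tameLocalReceptacle hR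

-- residual shape: S ↔ Target ∧ B, and a refutation of B is Target ∧ ¬S
example : _root_.ABC ↔ (BalancedFreySzpiro ∧ CompactBalanceTransfer) :=
  Summit.ABC.ABC.Theorems.CompactBalanceTransfer.Negative.abc_iff_target_and_compactBalanceTransfer
example : ¬ CompactBalanceTransfer ↔ (BalancedFreySzpiro ∧ ¬ _root_.ABC) :=
  Summit.ABC.ABC.Theorems.CompactBalanceTransfer.Negative.not_compactBalanceTransfer_iff_target

-- B is literally Target → S
example : CompactBalanceTransfer ↔ (BalancedFreySzpiro → _root_.ABC) :=
  Summit.ABC.ABC.Theorems.CompactBalanceTransfer.Negative.compactBalanceTransfer_iff_target_imp_abc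

-- S → Target is landed (the Target is a consequence of S too), so Target is NOT "S in disguise" only if Target → S is open: that is B.
example : _root_.ABC → BalancedFreySzpiro := Summit.ABC.ABC.Theorems.balancedFreySzpiro_of_abc

-- non-vacuity anchor: the compactly balanced cell (κ = 1/3) is inhabited at every height
example (n : ℕ) (hn : 1 ≤ n) : IsABCTriple n (n + 1) (2 * n + 1) ∧
    (1 / 3 : ℝ) * ((2 * n + 1 : ℕ) : ℝ) ≤ (n : ℝ) ∧ (1 / 3 : ℝ) * ((2 * n + 1 : ℕ) : ℝ) ≤ ((n + 1 : ℕ) : ℝ) := by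
  refine ⟨⟨by omega, by omega, by ring, ?_⟩, ?_, ?_⟩
  · exact Nat.coprime_self_add_right.mpr (Nat.coprime_one_right n)
  · have : (1 : ℝ) ≤ (n : ℝ) := by exact_mod_cast hn
    push_cast; linarith
  · push_cast
    have : (0 : ℝ) ≤ (n : ℝ) := Nat.cast_nonneg n
    linarith
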